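import Literature.MathematicalPhysics.QuantumFieldTheory.Balaban1983to89.B5QGGQ145Torus
import Literature.MathematicalPhysics.QuantumFieldTheory.Balaban1983to89.QGQInverse

/-!
# `Balaban1983to89.B5QGGQ145Bounds` — B5 p. 26: `γ₀ ≦ Q′_kG′_k²Q′_k^* ≦ γ₁` AS OPERATOR INEQUALITIES ON THE
# FINITE TORUS, UNIFORM IN `k` AND IN THE VOLUME; the inverse operator's bounds; `Q′G′²Q′^*` and its inverse kernel
# are REAL SYMMETRIC; the real-matrix packaging `QGQInverse.Coercive (qggqRe n a N) γ₀`

T. Bałaban, *Propagators and renormalization transformations for lattice gauge theories. I*, Commun. Math. Phys.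
**95**, 17–40 (1984) [Balaban1984PropagatorsI] (cell paper B5): p. 25 [PDF 9], the paragraph after (1.44), and p. 26
[PDF 10], the sentence after display (1.45).  Renders `1984-cmp95-propagators-rt-I-p009-x2.png`,
`1984-cmp95-propagators-rt-I-p010-x2.png` (cell folder `b2b-balaban-ref1/pages/`) read as images by this seat's lineage
(b05-g7; the same renders as the sibling `B5QGGQ145Torus`).

CITATION HEADER (lean-in-tree rule 2026-08-18).  PRINTED, p. 25, verbatim: *"It is enough to prove that Q′_kG′_k²Q′_k^* is
positive definite. This operator is of course nonnegative and if for some ω defined on T₁^{(k)} we have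
⟨ω, Q′_kG′_k²Q′_k^*ω⟩ = ‖G′_kQ′_k^*ω‖² = 0, then Q′_k^*ω = 0, hence ω = 0. We have bounds 0 < Q′_kG′_k²Q′_k^* ≦ a^{−2}, and
they imply the existence of the inverse operator and a bound from below. To understand better the properties of this
operator we calculate the Fourier transform. It is a translation invariant operator on the unit lattice T₁^{(k)} and its
Fourier transform can be written using formula (2.48) from [2]."*  P. 26, verbatim, after display (1.45): *"From this
representation and from the bounds (2.51), (2.52) of that paper, it follows that there are positive constants γ₀, γ₁, in
fact γ₀ dependent only on d, γ₁ = a^{−2}, such that γ₀ ≦ Q′_kG′_k²Q′_k^* ≦ γ₁."*  ([2] = cell paper B4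
[Balaban1983RegularityDecay].)

WHAT THE CELL ALREADY HAS (imported, untouched).  The sibling `B5QGGQ145Torus` (b05-g7): the matrix
`qggq n a m2 N y y′ = ⟨G′Q′^*δ_y, G′Q′^*δ_{y′}⟩_ξ` of `Q′_kG′_k²Q′_k^*` on the unit torus `T₁ = Π_μ ℤ/N_μ`, the operator
identity (1.45) `qggq_zero_eq_circ` (`qggq = circ_N(mReg(p′_k))`, the circulant whose eigenvalues are the multiplier at
the dual momenta), the circulant calculus `circ`/`circ_conv`/`circ_one`, pointwise positivity of the eigenvalues
`mRegr_pos`, and `torusKernel145M_conv_qggq` / `qggq_conv_torusKernel145M` (pv17's kernel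
`B5Torus145Decay.torusKernel145M = circ_N(mReg(p′_k)⁻¹)` is the two-sided convolution inverse).  pv17/b04-g3 (symbol level):
the `k`-UNIFORM window `B5Strip145.UniformStrip145 d a₋ a₊` (`∃ κ c C, 0 < κ ∧ 0 < c ∧ ∀ n ≥ 1, ∀ a ∈ [a₋,a₊], ∀ p ∈ Strip,
E ≠ 0 ∧ c ≤ ‖mReg‖ ≤ C`) and its proof `B5Strip145Leaves.uniformStrip145_holds` (hypothesis `0 < a₋` only);
`B4ContourShift.ofRealVec_mem_Strip` (the real zone lies in every strip), `B4TorusGreen244.dualMomentum_mem_BZ`.  b04: the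
real-matrix interface `QGQInverse.Coercive S γ := ∀ x, γ (x·x) ≤ x·(Sx)` — hypothesis `hco : QGQInverse.Coercive
(B * G * G * Bst) γ₀` of pv15's `B5Decay126.decay126_torus` ((1.26) on the torus).  LOCATED GAP (cell census G-B5-35 (i),
(ii); `B5QGGQ145Torus` header "NOT typed here: the uniform lower bound γ₀ ≤ Q′G′²Q′^* as an operator inequality"): the
printed sentence `γ₀ ≦ Q′_kG′_k²Q′_k^* ≦ γ₁` and "a bound from below" for the inverse were typed only pointwise on the
symbol, never as `k`- and volume-uniform OPERATOR inequalities, and the operator was not packaged as the real matrix the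
(1.26) interface consumes.

THIS FILE (journal node QGGQ-145-OPERATOR-BOUNDS of the cell `pub-balaban`, unit b2b-balaban-b05-g7) closes it, sorry-free:
* §1 [folklore] reality and symmetry: `opD_conj` (`D` has real coefficients), **`conj_KT`** (`K_T = G′Q′^*δ_y` is real, by
  `torusGreen244_unique`), `qggq_symm` / `conj_qggq` / `qggq_im` (`Q′G′²Q′^*` is a REAL SYMMETRIC kernel, `a > 0`,
  `m² ≥ 0`), `conj_torusKernel145M` (conjugation reflects the inverse kernel);
* §2 [folklore] finite Fourier analysis on `T₁` in b04's character language: `dft` (`ω̂(k) = Σ_y ω(y)e^{−ip′_k·y}`),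
  **`form_circ`** (`Σ_{y,y′} ω̄(y) circ_f(y−y′) ω(y′) = (Π_μN_μ)⁻¹ Σ_k f(k)|ω̂(k)|²`), **`plancherel_box`** /
  `plancherel_box_real` (`Σ_y|ω(y)|² = (Π_μN_μ)⁻¹ Σ_k|ω̂(k)|²`);
* §3 the eigenvalues `ev n a N k = 𝒩_r(p′_k)/E_r(p′_k)²` (real, `> 0`: `ev_pos`; `= mReg(p′_k)`: `mReg_dual_eq_ev`),
  **`form_qggq`** (`⟨ω,Q′G′²Q′^*ω⟩ = (Π_μN_μ)⁻¹ Σ_k ev(k)|ω̂(k)|²`, the printed "translation invariant … Fourier transform"),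
  `form_qggq_bounds` (eigenvalue window ⇒ operator window), **`ev_window`** (`UniformStrip145` on the real zone: ONE window
  `0 < γ₀ ≤ ev ≤ γ₁` for all `n ≥ 1`, `a ∈ [a₋,a₊]`, `N`, `k`) and **`qggq_operator_bounds`**: the printed
  `γ₀ ≦ Q′_kG′_k²Q′_k^* ≦ γ₁` AS OPERATOR INEQUALITIES `γ₀Σ|ω|² ≤ Re⟨ω,Q′G′²Q′^*ω⟩ ≤ γ₁Σ|ω|²`, `Im = 0`, with constants
  uniform in `k` (`n = L^k`), in the volume `N` and in `a ∈ [a₋,a₊]`;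
* §4 **`inverse_operator_bounds`**: `γ₁⁻¹Σ|ω|² ≤ Re⟨ω,(Q′G′²Q′^*)⁻¹ω⟩ ≤ γ₀⁻¹Σ|ω|²` for the operator with kernel
  `torusKernel145M` — the printed "existence of the inverse operator and a bound from below", uniformly;
* §5 the REAL-MATRIX PACKAGING on the coarse index `Idx N = Π_μ Fin N_μ` (= `B4Sect5Torus.TSite (d+1) N`): `toZ`,
  `sum_box_eq_sum_idx`, `qggqRe` / `kerRe` (the kernels as `Matrix (Idx N) (Idx N) ℝ`; `qggqRe_coe`, `kerRe_coe`: their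
  entries ARE the complex kernels), `dotProduct_qggqRe_mulVec`, **`qggqRe_window`** and **`coercive_qggqRe`**
  (`∃ γ₀ > 0, ∀ n ≥ 1, ∀ a ∈ [a₋,a₊], ∀ N, QGQInverse.Coercive (qggqRe n a N) γ₀` — hypothesis `hco` of `decay126_torus`
  in the multiplier model, modulo the carrier dictionary below), **`kerRe_mul_qggqRe`** / `qggqRe_mul_kerRe` /
  **`qggqRe_inv`** (`(qggqRe)⁻¹ = kerRe`), **`torusKernel145M_im`** / `torusKernel145M_even` / `kerRe_isSymm` (the inverse
  kernel is REAL and EVEN: `I·qggqRe = 0 ⇒ I = I·qggqRe·kerRe = 0`, then periodicity).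

DICTIONARY / HONEST SCOPE.  As in `B5QGGQ145Torus` (ξ-units, `n = L^k = ξ⁻¹ ≥ 1`, unit torus `Π_μ ℤ/N_μ` with a period
VECTOR, `m² = 0` for (1.45), scalar fields `U = 1`, complex-valued test functions with conj on the first factor, the
multiplier in pv17's regrouped form `mReg`).  The quadratic form is stated through `.re`/`.im` of the complex double sum
(it IS real: `form_qggq_im`).  CONSTANTS: `γ₀, γ₁` are EXISTENTIAL, produced from the cell's `UniformStrip145` witnesses
(`γ₀ := c`, `γ₁ := max c C`); they depend on `d, a₋, a₊` through the four analytic leaves.  NOT asserted: the printed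
"γ₀ dependent only on d" (our `γ₀` carries the `a`-window `[a₋,a₊]`; no claim either way about `a`-independence) and the
printed "γ₁ = a^{−2}" (FALSE for large `a`: cell census G-B5-13, `B5.printed_gamma1_fails`; `a⁻²` is the eigenvalue at
`p′ = 0`, `B5QGGQ145Torus.mReg_at_zero`, not the top of the spectrum in general).  NOT typed here: the carrier dictionary
`Idx N`/`box N` ↔ pv15's `B5AveragingTorus.UT N` and the identification of `qggqRe` with an instance of the abstract
product `B * G * G * Bst` of `decay126_torus` (cell census G-B5-35 (iii)); the Plancherel of b05's `B5Prop11Plancherel`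
lives on the carrier `Π_μ ZMod (N_μ)` and is not bridged (this file's `plancherel_box` is self-contained on `box N`); the
`η`-rescaling conventions; gauge-covariant `Q′_k(U)`.  Value = kernel certificate of two printed sentences (p. 25 "the
existence of the inverse operator and a bound from below", p. 26 "γ₀ ≦ Q′_kG′_k²Q′_k^* ≦ γ₁") as volume- and `k`-uniform
operator inequalities on the finite torus, plus the real-matrix packaging, NOT summit progress.  Staged byte-identically
under `HOME/lean/BalabanYm4/`.

Tags: 11 `[cite: …]` (the objects `ev`, `qggqRe`, `kerRe` and the statements that ARE the printed sentences or their
operator/matrix forms: `form_qggq`, `ev_window`, `qggq_operator_bounds`, `inverse_operator_bounds`, `qggqRe_window`,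
`coercive_qggqRe`, `kerRe_mul_qggqRe`, `qggqRe_inv`), 39 `[folklore]` (conjugation, finite Fourier algebra, order
bookkeeping, index packaging).  No `sorry`, no new axioms; imports `B5QGGQ145Torus` (b05-g7) and `QGQInverse` (b04)
only.
-/

namespace Literature.MathematicalPhysics.QuantumFieldTheory.Balaban1983to89.B5QGGQ145Bounds

open Complex Finset ComplexConjugate UnitAddTorus
open Literature.MathematicalPhysics.QuantumFieldTheory.Balaban1983to89.B4Strip
open Literature.MathematicalPhysics.QuantumFieldTheory.Balaban1983to89.B4ContourShift
open Literature.MathematicalPhysics.QuantumFieldTheory.Balaban1983to89.B4TorusKernel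
open Literature.MathematicalPhysics.QuantumFieldTheory.Balaban1983to89.B4Green244
open Literature.MathematicalPhysics.QuantumFieldTheory.Balaban1983to89.B4TorusGreen244
open Literature.MathematicalPhysics.QuantumFieldTheory.Balaban1983to89.B4TorusPositivity
open Literature.MathematicalPhysics.QuantumFieldTheory.Balaban1983to89.B5Strip145
open Literature.MathematicalPhysics.QuantumFieldTheory.Balaban1983to89.B5Strip145Leaves
open Literature.MathematicalPhysics.QuantumFieldTheory.Balaban1983to89.B5Torus145Decay
open Literature.MathematicalPhysics.QuantumFieldTheory.Balaban1983to89.B5QGGQ145Torus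
open scoped Real Matrix

noncomputable section

variable {d : ℕ}

/-! ### §1 `K_T` is real; `Q′G′²Q′^*` is real symmetric -/

/-- `D = −Δ^ξ + m² + aQ^*Q` has real coefficients: it commutes with complex conjugation. [folklore] -/
theorem opD_conj (n : ℕ) (a m2 : ℝ) (φ : (Fin (d + 1) → ℤ) → ℂ) (z : Fin (d + 1) → ℤ) :
    opD n a m2 (fun w => conj (φ w)) z = conj (opD n a m2 φ z) := by
  simp only [opD, negLap, blockAvg, map_add, map_mul, map_sub, map_sum, map_pow, map_natCast, map_inv₀,
    Complex.conj_ofReal, map_ofNat]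

/-- **`K_T = G′Q′^*δ_y` IS REAL-VALUED**: the conjugate of the periodic solution of `Dψ = Q^*δ^T_y` is again a periodic
solution (real data, real coefficients), hence equal to it (`torusGreen244_unique`). [folklore] -/
theorem conj_KT (n : ℕ) [NeZero n] (hn1 : 1 ≤ n) (a m2 : ℝ) (ha : 0 < a) (hm : 0 ≤ m2) {N : Fin (d + 1) → ℕ}
    (hN : ∀ i, 1 ≤ N i) (z y : Fin (d + 1) → ℤ) : conj (KT n a m2 N z y) = KT n a m2 N z y := by
  have hper : IsPeriodic (fun i => n * N i) (fun w => conj (KT n a m2 N w y)) := fun w m =>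
    congrArg conj (KT_isPeriodic n a m2 hN y w m)
  have hD : ∀ w, opD n a m2 (fun w => conj (KT n a m2 N w y)) w
      = if ∀ i, (N i : ℤ) ∣ coarse n w i - y i then 1 else 0 := fun w => by
    rw [opD_conj, torusGreen244 n hn1 a m2 ha hm hN w y]
    split_ifs <;> simp
  exact congrFun (torusGreen244_unique n hn1 a m2 ha hm hN y _ hper hD) z

/-- `Q′G′²Q′^*` is Hermitian: `\overline{qggq(y,y′)} = qggq(y′,y)` (every `n`, `a`, `m²`, `N`). [folklore] -/
theorem conj_qggq_swap (n : ℕ) [NeZero n] (a m2 : ℝ) (N : Fin (d + 1) → ℕ) (y y' : Fin (d + 1) → ℤ) :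
    conj (qggq n a m2 N y y') = qggq n a m2 N y' y := by
  unfold qggq
  rw [map_mul, map_inv₀, map_pow, map_natCast, map_sum]
  refine congrArg _ (Finset.sum_congr rfl fun z _ => ?_)
  rw [map_mul, Complex.conj_conj, mul_comm]

/-- **`Q′G′²Q′^*` IS SYMMETRIC**: `qggq(y,y′) = qggq(y′,y)` (`K_T` real). [folklore] -/
theorem qggq_symm (n : ℕ) [NeZero n] (hn1 : 1 ≤ n) (a m2 : ℝ) (ha : 0 < a) (hm : 0 ≤ m2) {N : Fin (d + 1) → ℕ}
    (hN : ∀ i, 1 ≤ N i) (y y' : Fin (d + 1) → ℤ) : qggq n a m2 N y y' = qggq n a m2 N y' y := by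
  unfold qggq
  refine congrArg _ (Finset.sum_congr rfl fun z _ => ?_)
  rw [conj_KT n hn1 a m2 ha hm hN, conj_KT n hn1 a m2 ha hm hN, mul_comm]

/-- **`Q′G′²Q′^*` IS REAL**: `\overline{qggq(y,y′)} = qggq(y,y′)`. [folklore] -/
theorem conj_qggq (n : ℕ) [NeZero n] (hn1 : 1 ≤ n) (a m2 : ℝ) (ha : 0 < a) (hm : 0 ≤ m2) {N : Fin (d + 1) → ℕ}
    (hN : ∀ i, 1 ≤ N i) (y y' : Fin (d + 1) → ℤ) : conj (qggq n a m2 N y y') = qggq n a m2 N y y' := by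
  rw [conj_qggq_swap, qggq_symm n hn1 a m2 ha hm hN]

/-- the entries of `Q′G′²Q′^*` have zero imaginary part. [folklore] -/
theorem qggq_im (n : ℕ) [NeZero n] (hn1 : 1 ≤ n) (a m2 : ℝ) (ha : 0 < a) (hm : 0 ≤ m2) {N : Fin (d + 1) → ℕ}
    (hN : ∀ i, 1 ≤ N i) (y y' : Fin (d + 1) → ℤ) : (qggq n a m2 N y y').im = 0 :=
  Complex.conj_eq_iff_im.mp (conj_qggq n hn1 a m2 ha hm hN y y')

/-- the multiplier is real at real momenta: `\overline{mReg(p)} = mReg(p)` for `p ∈ ℝ^{d+1}`. [folklore] -/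
theorem conj_mReg_ofReal {m : ℕ} (n : ℕ) [NeZero n] (a : ℝ) (s : Fin m → ℝ) :
    conj (mReg n a (ofRealVec s)) = mReg n a (ofRealVec s) := by
  rw [mReg_ofReal, Complex.conj_ofReal]

/-- conjugating the inverse-multiplier kernel reflects its argument (`mReg` is real at real momenta). [folklore] -/
theorem conj_torusKernel145M (n : ℕ) [NeZero n] (a : ℝ) (N : Fin (d + 1) → ℕ) (x : Fin (d + 1) → ℤ) :
    conj (torusKernel145M n a N x) = torusKernel145M n a N (-x) := by
  rw [torusKernel145M_eq_circ, torusKernel145M_eq_circ]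
  unfold circ
  rw [map_mul, map_inv₀, map_prod, map_sum]
  congr 1
  · exact congrArg _ (Finset.prod_congr rfl fun i _ => map_natCast _ _)
  · refine Finset.sum_congr rfl fun k _ => ?_
    simp only [map_mul, map_inv₀, conj_mReg_ofReal, ← mFourier_neg]

/-! ### §2 Finite Fourier analysis on the unit torus `Π_μ ℤ/N_μ` in b04's character language -/

/-- the finite Fourier coefficient `ω̂(k) = Σ_{y ∈ Π_μ[0,N_μ)} ω(y) \overline{e^{ip′_k·y}}`. [folklore] -/
def dft (N : Fin (d + 1) → ℕ) (ω : (Fin (d + 1) → ℤ) → ℂ) (k : (i : Fin (d + 1)) → Fin (N i)) : ℂ :=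
  ∑ y ∈ box N, ω y * conj (mFourier y (MultiPeriod.gridPt N k))

/-- **THE QUADRATIC FORM OF A CIRCULANT IS DIAGONAL IN THE FOURIER COEFFICIENTS**:
`Σ_{y,y′∈T₁} \overline{ω(y)} circ_f(y−y′) ω(y′) = (Π_μN_μ)⁻¹ Σ_k f(k) |ω̂(k)|²`. [folklore] -/
theorem form_circ {N : Fin (d + 1) → ℕ} (f : ((i : Fin (d + 1)) → Fin (N i)) → ℂ) (ω : (Fin (d + 1) → ℤ) → ℂ) :
    ∑ y ∈ box N, ∑ y' ∈ box N, conj (ω y) * circ N f (y - y') * ω y'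
      = (∏ i, ((N i : ℕ) : ℂ))⁻¹ *
          ∑ k : (i : Fin (d + 1)) → Fin (N i), f k * (conj (dft N ω k) * dft N ω k) := by
  classical
  set C : ℂ := (∏ i, ((N i : ℕ) : ℂ))⁻¹ with hC
  have h1 : ∀ y y' : Fin (d + 1) → ℤ, conj (ω y) * circ N f (y - y') * ω y'
      = ∑ k : (i : Fin (d + 1)) → Fin (N i), C * f k *
          ((conj (ω y) * mFourier y (MultiPeriod.gridPt N k))
            * (ω y' * conj (mFourier y' (MultiPeriod.gridPt N k)))) := by
    intro y y'
    unfold circ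
    rw [← hC, Finset.mul_sum, Finset.mul_sum, Finset.sum_mul]
    refine Finset.sum_congr rfl fun k _ => ?_
    rw [sub_eq_add_neg, mFourier_add, mFourier_neg]
    ring
  have h2 : ∀ k : (i : Fin (d + 1)) → Fin (N i), conj (dft N ω k) * dft N ω k
      = ∑ y ∈ box N, ∑ y' ∈ box N,
          (conj (ω y) * mFourier y (MultiPeriod.gridPt N k))
            * (ω y' * conj (mFourier y' (MultiPeriod.gridPt N k))) := by
    intro k
    unfold dft
    rw [map_sum, Finset.sum_mul_sum]
    refine Finset.sum_congr rfl fun y _ => Finset.sum_congr rfl fun y' _ => ?_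
    rw [map_mul, Complex.conj_conj]
  simp_rw [h1, h2]
  calc ∑ y ∈ box N, ∑ y' ∈ box N, ∑ k : (i : Fin (d + 1)) → Fin (N i), C * f k *
          ((conj (ω y) * mFourier y (MultiPeriod.gridPt N k))
            * (ω y' * conj (mFourier y' (MultiPeriod.gridPt N k))))
      = ∑ y ∈ box N, ∑ k : (i : Fin (d + 1)) → Fin (N i), ∑ y' ∈ box N, C * f k *
          ((conj (ω y) * mFourier y (MultiPeriod.gridPt N k))
            * (ω y' * conj (mFourier y' (MultiPeriod.gridPt N k)))) :=
        Finset.sum_congr rfl fun y _ => Finset.sum_comm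
    _ = ∑ k : (i : Fin (d + 1)) → Fin (N i), ∑ y ∈ box N, ∑ y' ∈ box N, C * f k *
          ((conj (ω y) * mFourier y (MultiPeriod.gridPt N k))
            * (ω y' * conj (mFourier y' (MultiPeriod.gridPt N k)))) := Finset.sum_comm
    _ = _ := by
        rw [Finset.mul_sum]
        refine Finset.sum_congr rfl fun k _ => ?_
        rw [Finset.mul_sum, Finset.mul_sum]
        refine Finset.sum_congr rfl fun y _ => ?_
        rw [Finset.mul_sum, Finset.mul_sum]
        refine Finset.sum_congr rfl fun y' _ => ?_
        ring

/-- **PLANCHEREL ON THE UNIT TORUS**: `Σ_{y∈T₁} |ω(y)|² = (Π_μN_μ)⁻¹ Σ_k |ω̂(k)|²` (the identity circulant `circ_one`).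
[folklore] -/
theorem plancherel_box {N : Fin (d + 1) → ℕ} (hN : ∀ i, 1 ≤ N i) (ω : (Fin (d + 1) → ℤ) → ℂ) :
    ∑ y ∈ box N, conj (ω y) * ω y
      = (∏ i, ((N i : ℕ) : ℂ))⁻¹ * ∑ k : (i : Fin (d + 1)) → Fin (N i), conj (dft N ω k) * dft N ω k := by
  classical
  have h := form_circ (N := N) (fun _ => (1 : ℂ)) ω
  simp only [one_mul] at h
  rw [← h]
  refine Finset.sum_congr rfl fun y hy => ?_
  rw [Finset.sum_congr rfl fun y' hy' => by
    rw [circ_one hN, if_congr (by simp only [Pi.sub_apply]; exact dvd_sub_iff_eq_of_mem_box hy hy') rfl rfl]]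
  rw [Finset.sum_eq_single y (fun y' _ hne => by rw [if_neg (Ne.symm hne), mul_zero, zero_mul])
    (fun h => absurd hy h)]
  rw [if_pos rfl, mul_one]

/-- Plancherel, real form: `Σ_{y∈T₁} ‖ω(y)‖² = (Π_μN_μ)⁻¹ Σ_k ‖ω̂(k)‖²`. [folklore] -/
theorem plancherel_box_real {N : Fin (d + 1) → ℕ} (hN : ∀ i, 1 ≤ N i) (ω : (Fin (d + 1) → ℤ) → ℂ) :
    ∑ y ∈ box N, ‖ω y‖ ^ 2
      = (∏ i, ((N i : ℕ) : ℝ))⁻¹ * ∑ k : (i : Fin (d + 1)) → Fin (N i), ‖dft N ω k‖ ^ 2 := by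
  have h := plancherel_box hN ω
  simp_rw [Complex.conj_mul', ← Complex.ofReal_pow] at h
  rw [← Complex.ofReal_sum, ← Complex.ofReal_sum] at h
  have h2 : ((∏ i, ((N i : ℕ) : ℂ))⁻¹ : ℂ) = (((∏ i, ((N i : ℕ) : ℝ))⁻¹ : ℝ) : ℂ) := by
    push_cast; rfl
  rw [h2, ← Complex.ofReal_mul] at h
  exact_mod_cast h

/-! ### §3 The eigenvalues of `Q′G′²Q′^*` on the torus and the operator inequalities `γ₀ ≤ Q′G′²Q′^* ≤ γ₁` -/

/-- the eigenvalue of `Q′_kG′_k²Q′_k^*` at the dual momentum `p′_k`: `mReg_r(p′_k) = 𝒩_r(p′_k)/E_r(p′_k)²` (a REAL number).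
[cite: Balaban1984PropagatorsI, (1.45) p.26] -/
def ev (n : ℕ) [NeZero n] (a : ℝ) (N : Fin (d + 1) → ℕ) (k : (i : Fin (d + 1)) → Fin (N i)) : ℝ :=
  Ncalr n (dualMomentum N k) / Er n a 0 (dualMomentum N k) ^ 2

/-- the multiplier at a dual momentum is the real eigenvalue. [folklore] -/
theorem mReg_dual_eq_ev (n : ℕ) [NeZero n] (a : ℝ) (N : Fin (d + 1) → ℕ) (k : (i : Fin (d + 1)) → Fin (N i)) :
    mReg n a (ofRealVec (dualMomentum N k)) = ((ev n a N k : ℝ) : ℂ) := by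
  unfold ev
  exact mReg_ofReal n a _

/-- every eigenvalue is positive (`mRegr_pos`). [folklore] -/
theorem ev_pos (n : ℕ) [NeZero n] (hn1 : 1 ≤ n) (a : ℝ) (ha : 0 < a) (N : Fin (d + 1) → ℕ)
    (k : (i : Fin (d + 1)) → Fin (N i)) : 0 < ev n a N k := by
  have hp := dualMomentum_mem_BZ N k
  unfold ev
  exact mRegr_pos n hn1 a ha _ fun μ => abs_le.mpr ⟨hp.1 μ, hp.2 μ⟩

/-- the norm of the multiplier at a dual momentum is the eigenvalue. [folklore] -/
theorem norm_mReg_dual (n : ℕ) [NeZero n] (hn1 : 1 ≤ n) (a : ℝ) (ha : 0 < a) (N : Fin (d + 1) → ℕ)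
    (k : (i : Fin (d + 1)) → Fin (N i)) : ‖mReg n a (ofRealVec (dualMomentum N k))‖ = ev n a N k := by
  rw [mReg_dual_eq_ev, Complex.norm_real, Real.norm_eq_abs, abs_of_pos (ev_pos n hn1 a ha N k)]

/-- **THE QUADRATIC FORM OF `Q′G′²Q′^*` IN FOURIER VARIABLES**:
`⟨ω, Q′G′²Q′^*ω⟩_{T₁} = (Π_μN_μ)⁻¹ Σ_k mReg(p′_k) |ω̂(k)|²`. [cite: Balaban1984PropagatorsI, (1.45) p.26 and p.25
("It is a translation invariant operator on the unit lattice T₁^{(k)} and its Fourier transform can be written …")] -/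
theorem form_qggq (n : ℕ) [NeZero n] (hn1 : 1 ≤ n) (a : ℝ) {N : Fin (d + 1) → ℕ} (hN : ∀ i, 1 ≤ N i)
    (ω : (Fin (d + 1) → ℤ) → ℂ) :
    ∑ y ∈ box N, ∑ y' ∈ box N, conj (ω y) * qggq n a 0 N y y' * ω y'
      = (∏ i, ((N i : ℕ) : ℂ))⁻¹ *
          ∑ k : (i : Fin (d + 1)) → Fin (N i), ((ev n a N k : ℝ) : ℂ) * (conj (dft N ω k) * dft N ω k) := by
  simp_rw [qggq_zero_eq_circ n hn1 a hN, form_circ, mReg_dual_eq_ev]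

/-- the same, as a real number: `Re⟨ω, Q′G′²Q′^*ω⟩ = (Π_μN_μ)⁻¹ Σ_k ev(k) ‖ω̂(k)‖²`. [folklore] -/
theorem form_qggq_re (n : ℕ) [NeZero n] (hn1 : 1 ≤ n) (a : ℝ) {N : Fin (d + 1) → ℕ} (hN : ∀ i, 1 ≤ N i)
    (ω : (Fin (d + 1) → ℤ) → ℂ) :
    (∑ y ∈ box N, ∑ y' ∈ box N, conj (ω y) * qggq n a 0 N y y' * ω y').re
      = (∏ i, ((N i : ℕ) : ℝ))⁻¹ * ∑ k : (i : Fin (d + 1)) → Fin (N i), ev n a N k * ‖dft N ω k‖ ^ 2 := by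
  rw [form_qggq n hn1 a hN]
  simp_rw [Complex.conj_mul', ← Complex.ofReal_pow, ← Complex.ofReal_mul]
  rw [← Complex.ofReal_sum]
  have h2 : ((∏ i, ((N i : ℕ) : ℂ))⁻¹ : ℂ) = (((∏ i, ((N i : ℕ) : ℝ))⁻¹ : ℝ) : ℂ) := by
    push_cast; rfl
  rw [h2, ← Complex.ofReal_mul, Complex.ofReal_re]

/-- the quadratic form of `Q′G′²Q′^*` is real. [folklore] -/
theorem form_qggq_im (n : ℕ) [NeZero n] (hn1 : 1 ≤ n) (a : ℝ) {N : Fin (d + 1) → ℕ} (hN : ∀ i, 1 ≤ N i)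
    (ω : (Fin (d + 1) → ℤ) → ℂ) :
    (∑ y ∈ box N, ∑ y' ∈ box N, conj (ω y) * qggq n a 0 N y y' * ω y').im = 0 := by
  rw [form_qggq n hn1 a hN]
  simp_rw [Complex.conj_mul', ← Complex.ofReal_pow, ← Complex.ofReal_mul]
  rw [← Complex.ofReal_sum]
  have h2 : ((∏ i, ((N i : ℕ) : ℂ))⁻¹ : ℂ) = (((∏ i, ((N i : ℕ) : ℝ))⁻¹ : ℝ) : ℂ) := by
    push_cast; rfl
  rw [h2, ← Complex.ofReal_mul, Complex.ofReal_im]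

/-- weighted sums between the extreme weights. [folklore] -/
theorem weighted_sum_bounds {ι : Type*} [Fintype ι] (e w : ι → ℝ) {c C : ℝ} (hw : ∀ k, 0 ≤ w k)
    (hc : ∀ k, c ≤ e k) (hC : ∀ k, e k ≤ C) :
    c * ∑ k, w k ≤ ∑ k, e k * w k ∧ ∑ k, e k * w k ≤ C * ∑ k, w k := by
  constructor
  · rw [Finset.mul_sum]
    exact Finset.sum_le_sum fun k _ => mul_le_mul_of_nonneg_right (hc k) (hw k)
  · rw [Finset.mul_sum]
    exact Finset.sum_le_sum fun k _ => mul_le_mul_of_nonneg_right (hC k) (hw k)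

/-- **FROM EIGENVALUE BOUNDS TO OPERATOR BOUNDS**: if `c ≤ ev(k) ≤ C` at every dual momentum of the torus, then
`c‖ω‖² ≤ Re⟨ω, Q′G′²Q′^*ω⟩ ≤ C‖ω‖²` on `T₁ = Π_μ ℤ/N_μ`. [folklore] -/
theorem form_qggq_bounds (n : ℕ) [NeZero n] (hn1 : 1 ≤ n) (a : ℝ) {N : Fin (d + 1) → ℕ} (hN : ∀ i, 1 ≤ N i)
    {c C : ℝ} (hc : ∀ k : (i : Fin (d + 1)) → Fin (N i), c ≤ ev n a N k)
    (hC : ∀ k : (i : Fin (d + 1)) → Fin (N i), ev n a N k ≤ C) (ω : (Fin (d + 1) → ℤ) → ℂ) :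
    c * ∑ y ∈ box N, ‖ω y‖ ^ 2 ≤ (∑ y ∈ box N, ∑ y' ∈ box N, conj (ω y) * qggq n a 0 N y y' * ω y').re ∧
    (∑ y ∈ box N, ∑ y' ∈ box N, conj (ω y) * qggq n a 0 N y y' * ω y').re ≤ C * ∑ y ∈ box N, ‖ω y‖ ^ 2 := by
  rw [form_qggq_re n hn1 a hN, plancherel_box_real hN]
  have hP : 0 ≤ (∏ i, ((N i : ℕ) : ℝ))⁻¹ := inv_nonneg.mpr (Finset.prod_nonneg fun i _ => Nat.cast_nonneg _)
  obtain ⟨h1, h2⟩ := weighted_sum_bounds (ev n a N) (fun k => ‖dft N ω k‖ ^ 2) (fun k => sq_nonneg _) hc hC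
  constructor
  · calc c * ((∏ i, ((N i : ℕ) : ℝ))⁻¹ * ∑ k, ‖dft N ω k‖ ^ 2)
        = (∏ i, ((N i : ℕ) : ℝ))⁻¹ * (c * ∑ k, ‖dft N ω k‖ ^ 2) := by ring
      _ ≤ (∏ i, ((N i : ℕ) : ℝ))⁻¹ * ∑ k, ev n a N k * ‖dft N ω k‖ ^ 2 := mul_le_mul_of_nonneg_left h1 hP
  · calc (∏ i, ((N i : ℕ) : ℝ))⁻¹ * ∑ k, ev n a N k * ‖dft N ω k‖ ^ 2
        ≤ (∏ i, ((N i : ℕ) : ℝ))⁻¹ * (C * ∑ k, ‖dft N ω k‖ ^ 2) := mul_le_mul_of_nonneg_left h2 hP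
      _ = C * ((∏ i, ((N i : ℕ) : ℝ))⁻¹ * ∑ k, ‖dft N ω k‖ ^ 2) := by ring

/-- **UNIFORM EIGENVALUE WINDOW** (from the `k`-uniform strip `B5Strip145Leaves.uniformStrip145_holds` restricted to the
real zone, where `mReg = ev > 0`): for `0 < a₋ ≤ a₊` there are `0 < γ₀ ≤ γ₁` with `γ₀ ≤ ev_{n,a,N}(k) ≤ γ₁` for EVERY
`n = L^k ≥ 1`, `a ∈ [a₋, a₊]`, every period vector `N` and every dual momentum `k`. [cite: Balaban1984PropagatorsI, p.26,
the sentence after (1.45) ("there are positive constants γ₀, γ₁ … such that γ₀ ≦ Q′_kG′_k²Q′_k* ≦ γ₁")] -/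
theorem ev_window (d : ℕ) (aminus aplus : ℝ) (ha : 0 < aminus) :
    ∃ γ₀ γ₁ : ℝ, 0 < γ₀ ∧ γ₀ ≤ γ₁ ∧ ∀ (n : ℕ) [NeZero n], 1 ≤ n → ∀ a : ℝ, aminus ≤ a → a ≤ aplus →
      ∀ (N : Fin (d + 1) → ℕ) (k : (i : Fin (d + 1)) → Fin (N i)), γ₀ ≤ ev n a N k ∧ ev n a N k ≤ γ₁ := by
  obtain ⟨κ, c, C, hκ, hc, h⟩ := uniformStrip145_holds (d + 1) aminus aplus ha
  refine ⟨c, max c C, hc, le_max_left _ _, fun n _ hn1 a ha1 ha2 N k => ?_⟩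
  have ha0 : 0 < a := lt_of_lt_of_le ha ha1
  obtain ⟨-, h1, h2⟩ := h n a ha1 ha2 _ (ofRealVec_mem_Strip hκ.le (dualMomentum_mem_BZ N k))
  rw [norm_mReg_dual n hn1 a ha0 N k] at h1 h2
  exact ⟨h1, h2.trans (le_max_right _ _)⟩

/-- **B5 p. 26, `γ₀ ≦ Q′_kG′_k²Q′_k^* ≦ γ₁`, AS OPERATOR INEQUALITIES ON THE FINITE TORUS, UNIFORMLY IN `k` AND IN THE
VOLUME**: for `0 < a₋ ≤ a₊` there are constants `0 < γ₀ ≤ γ₁` (those of `ev_window`: from the cell's `k`-uniform strip for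
(1.45), depending on `d, a₋, a₊` only) such that for every `n = L^k ≥ 1`, every `a ∈ [a₋, a₊]`, every torus `Π_μ ℤ/N_μ`
(`N_μ ≥ 1`) and every `ω : T₁ → ℂ`:
`γ₀ Σ_y |ω(y)|² ≤ ⟨ω, Q′G′²Q′^*ω⟩ ≤ γ₁ Σ_y |ω(y)|²`, the form being real.  HONEST SCOPE: the printed values "γ₀ dependent
only on d, γ₁ = a⁻²" are NOT asserted — `γ₁ = a⁻²` is false for large `a` (cell census G-B5-13, `B5.printed_gamma1_fails`),
and the constants here carry the `a`-window. [cite: Balaban1984PropagatorsI, p.26, the sentence after (1.45); p.25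
("We have bounds 0 < Q′_kG′_k²Q′_k* ≦ a⁻², and they imply the existence of the inverse operator and a bound from below")] -/
theorem qggq_operator_bounds (d : ℕ) (aminus aplus : ℝ) (ha : 0 < aminus) :
    ∃ γ₀ γ₁ : ℝ, 0 < γ₀ ∧ γ₀ ≤ γ₁ ∧ ∀ (n : ℕ) [NeZero n], 1 ≤ n → ∀ a : ℝ, aminus ≤ a → a ≤ aplus →
      ∀ (N : Fin (d + 1) → ℕ), (∀ i, 1 ≤ N i) → ∀ ω : (Fin (d + 1) → ℤ) → ℂ,
        γ₀ * ∑ y ∈ box N, ‖ω y‖ ^ 2 ≤ (∑ y ∈ box N, ∑ y' ∈ box N, conj (ω y) * qggq n a 0 N y y' * ω y').re ∧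
        (∑ y ∈ box N, ∑ y' ∈ box N, conj (ω y) * qggq n a 0 N y y' * ω y').re ≤ γ₁ * ∑ y ∈ box N, ‖ω y‖ ^ 2 ∧
        (∑ y ∈ box N, ∑ y' ∈ box N, conj (ω y) * qggq n a 0 N y y' * ω y').im = 0 := by
  obtain ⟨γ₀, γ₁, h0, h01, h⟩ := ev_window d aminus aplus ha
  refine ⟨γ₀, γ₁, h0, h01, fun n _ hn1 a ha1 ha2 N hN ω => ?_⟩
  obtain ⟨h1, h2⟩ := form_qggq_bounds n hn1 a hN (fun k => (h n hn1 a ha1 ha2 N k).1)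
    (fun k => (h n hn1 a ha1 ha2 N k).2) ω
  exact ⟨h1, h2, form_qggq_im n hn1 a hN ω⟩

/-! ### §4 The inverse operator `(Q′G′²Q′^*)^{−1}` (kernel `torusKernel145M`): `γ₁⁻¹ ≤ (Q′G′²Q′^*)^{−1} ≤ γ₀⁻¹` -/

/-- **THE QUADRATIC FORM OF THE INVERSE IN FOURIER VARIABLES**:
`⟨ω, (Q′G′²Q′^*)⁻¹ω⟩ = (Π_μN_μ)⁻¹ Σ_k ev(k)⁻¹ |ω̂(k)|²`. [folklore] -/
theorem form_inverse (n : ℕ) [NeZero n] (a : ℝ) (N : Fin (d + 1) → ℕ) (ω : (Fin (d + 1) → ℤ) → ℂ) :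
    ∑ y ∈ box N, ∑ y' ∈ box N, conj (ω y) * torusKernel145M n a N (y - y') * ω y'
      = (∏ i, ((N i : ℕ) : ℂ))⁻¹ *
          ∑ k : (i : Fin (d + 1)) → Fin (N i), (((ev n a N k)⁻¹ : ℝ) : ℂ) * (conj (dft N ω k) * dft N ω k) := by
  simp_rw [torusKernel145M_eq_circ, form_circ, mReg_dual_eq_ev, ← Complex.ofReal_inv]

/-- the inverse form as a real number. [folklore] -/
theorem form_inverse_re (n : ℕ) [NeZero n] (a : ℝ) (N : Fin (d + 1) → ℕ) (ω : (Fin (d + 1) → ℤ) → ℂ) :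
    (∑ y ∈ box N, ∑ y' ∈ box N, conj (ω y) * torusKernel145M n a N (y - y') * ω y').re
      = (∏ i, ((N i : ℕ) : ℝ))⁻¹ * ∑ k : (i : Fin (d + 1)) → Fin (N i), (ev n a N k)⁻¹ * ‖dft N ω k‖ ^ 2 := by
  rw [form_inverse n a N]
  simp_rw [Complex.conj_mul', ← Complex.ofReal_pow, ← Complex.ofReal_mul]
  rw [← Complex.ofReal_sum]
  have h2 : ((∏ i, ((N i : ℕ) : ℂ))⁻¹ : ℂ) = (((∏ i, ((N i : ℕ) : ℝ))⁻¹ : ℝ) : ℂ) := by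
    push_cast; rfl
  rw [h2, ← Complex.ofReal_mul, Complex.ofReal_re]

/-- the inverse form is real. [folklore] -/
theorem form_inverse_im (n : ℕ) [NeZero n] (a : ℝ) (N : Fin (d + 1) → ℕ) (ω : (Fin (d + 1) → ℤ) → ℂ) :
    (∑ y ∈ box N, ∑ y' ∈ box N, conj (ω y) * torusKernel145M n a N (y - y') * ω y').im = 0 := by
  rw [form_inverse n a N]
  simp_rw [Complex.conj_mul', ← Complex.ofReal_pow, ← Complex.ofReal_mul]
  rw [← Complex.ofReal_sum]
  have h2 : ((∏ i, ((N i : ℕ) : ℂ))⁻¹ : ℂ) = (((∏ i, ((N i : ℕ) : ℝ))⁻¹ : ℝ) : ℂ) := by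
    push_cast; rfl
  rw [h2, ← Complex.ofReal_mul, Complex.ofReal_im]

/-- **"THE EXISTENCE OF THE INVERSE OPERATOR AND A BOUND FROM BELOW"** (p. 25), typed: the operator with kernel
`torusKernel145M` (= `(Q′_kG′_k²Q′_k^*)^{−1}` by `B5QGGQ145Torus.torusKernel145M_conv_qggq`) satisfies
`γ₁⁻¹ Σ|ω|² ≤ ⟨ω,(Q′G′²Q′^*)⁻¹ω⟩ ≤ γ₀⁻¹ Σ|ω|²`, uniformly in `k`, the volume and `a ∈ [a₋,a₊]` (constants of `ev_window`).
[cite: Balaban1984PropagatorsI, p.25 (the sentence "We have bounds 0 < Q′_kG′_k²Q′_k* ≦ a⁻², and they imply the existence of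
the inverse operator and a bound from below"); p.26 after (1.45)] -/
theorem inverse_operator_bounds (d : ℕ) (aminus aplus : ℝ) (ha : 0 < aminus) :
    ∃ γ₀ γ₁ : ℝ, 0 < γ₀ ∧ γ₀ ≤ γ₁ ∧ ∀ (n : ℕ) [NeZero n], 1 ≤ n → ∀ a : ℝ, aminus ≤ a → a ≤ aplus →
      ∀ (N : Fin (d + 1) → ℕ), (∀ i, 1 ≤ N i) → ∀ ω : (Fin (d + 1) → ℤ) → ℂ,
        γ₁⁻¹ * ∑ y ∈ box N, ‖ω y‖ ^ 2
          ≤ (∑ y ∈ box N, ∑ y' ∈ box N, conj (ω y) * torusKernel145M n a N (y - y') * ω y').re ∧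
        (∑ y ∈ box N, ∑ y' ∈ box N, conj (ω y) * torusKernel145M n a N (y - y') * ω y').re
          ≤ γ₀⁻¹ * ∑ y ∈ box N, ‖ω y‖ ^ 2 ∧
        (∑ y ∈ box N, ∑ y' ∈ box N, conj (ω y) * torusKernel145M n a N (y - y') * ω y').im = 0 := by
  obtain ⟨γ₀, γ₁, h0, h01, h⟩ := ev_window d aminus aplus ha
  refine ⟨γ₀, γ₁, h0, h01, fun n _ hn1 a ha1 ha2 N hN ω => ?_⟩
  have hP : 0 ≤ (∏ i, ((N i : ℕ) : ℝ))⁻¹ := inv_nonneg.mpr (Finset.prod_nonneg fun i _ => Nat.cast_nonneg _)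
  have hlo : ∀ k : (i : Fin (d + 1)) → Fin (N i), γ₁⁻¹ ≤ (ev n a N k)⁻¹ := fun k =>
    inv_anti₀ (h0.trans_le (h n hn1 a ha1 ha2 N k).1) (h n hn1 a ha1 ha2 N k).2
  have hhi : ∀ k : (i : Fin (d + 1)) → Fin (N i), (ev n a N k)⁻¹ ≤ γ₀⁻¹ := fun k =>
    inv_anti₀ h0 (h n hn1 a ha1 ha2 N k).1
  obtain ⟨h1, h2⟩ := weighted_sum_bounds (fun k => (ev n a N k)⁻¹) (fun k => ‖dft N ω k‖ ^ 2)
    (fun k => sq_nonneg _) hlo hhi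
  refine ⟨?_, ?_, form_inverse_im n a N ω⟩
  · rw [form_inverse_re, plancherel_box_real hN]
    calc γ₁⁻¹ * ((∏ i, ((N i : ℕ) : ℝ))⁻¹ * ∑ k, ‖dft N ω k‖ ^ 2)
        = (∏ i, ((N i : ℕ) : ℝ))⁻¹ * (γ₁⁻¹ * ∑ k, ‖dft N ω k‖ ^ 2) := by ring
      _ ≤ (∏ i, ((N i : ℕ) : ℝ))⁻¹ * ∑ k, (ev n a N k)⁻¹ * ‖dft N ω k‖ ^ 2 := mul_le_mul_of_nonneg_left h1 hP
  · rw [form_inverse_re, plancherel_box_real hN]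
    calc (∏ i, ((N i : ℕ) : ℝ))⁻¹ * ∑ k, (ev n a N k)⁻¹ * ‖dft N ω k‖ ^ 2
        ≤ (∏ i, ((N i : ℕ) : ℝ))⁻¹ * (γ₀⁻¹ * ∑ k, ‖dft N ω k‖ ^ 2) := mul_le_mul_of_nonneg_left h2 hP
      _ = γ₀⁻¹ * ((∏ i, ((N i : ℕ) : ℝ))⁻¹ * ∑ k, ‖dft N ω k‖ ^ 2) := by ring

/-! ### §5 Packaging as REAL MATRICES on the coarse index `Π_μ Fin N_μ`: `QGQInverse.Coercive (qggqRe n a N) γ₀`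
(hypothesis (β) of `B5Decay126.decay126_torus` in the multiplier model), the inverse matrix, and the reality and evenness
of the inverse kernel -/

/-- the coarse index of the torus `T₁ = Π_μ ℤ/N_μ`: `Π_μ Fin N_μ` (the same type as `B4Sect5Torus.TSite (d+1) N`).
[folklore] -/
abbrev Idx (N : Fin (d + 1) → ℕ) : Type := (i : Fin (d + 1)) → Fin (N i)

/-- the representative in `Π_μ [0,N_μ) ⊂ ℤ^{d+1}` of a coarse index. [folklore] -/
def toZ {N : Fin (d + 1) → ℕ} (k : Idx N) : Fin (d + 1) → ℤ := fun i => ((k i : ℕ) : ℤ)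

/-- representatives lie in the fundamental box. [folklore] -/
theorem toZ_mem_box {N : Fin (d + 1) → ℕ} (k : Idx N) : toZ k ∈ box N :=
  mem_box.mpr fun i => ⟨Int.natCast_nonneg _, by simp only [toZ]; exact_mod_cast (k i).isLt⟩

/-- distinct indices have distinct representatives. [folklore] -/
theorem toZ_injective {N : Fin (d + 1) → ℕ} : Function.Injective (toZ (N := N)) := by
  intro k k' h
  funext i
  have hi := congrFun h i
  simp only [toZ, Nat.cast_inj] at hi
  exact Fin.ext hi

/-- the representatives exhaust the fundamental box. [folklore] -/
theorem image_toZ (N : Fin (d + 1) → ℕ) : Finset.univ.image (toZ (N := N)) = box N := by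
  classical
  ext z
  simp only [Finset.mem_image, Finset.mem_univ, true_and]
  constructor
  · rintro ⟨k, rfl⟩
    exact toZ_mem_box k
  · intro hz
    rw [mem_box] at hz
    refine ⟨fun i => ⟨(z i).toNat, by have := hz i; omega⟩, funext fun i => ?_⟩
    simp only [toZ]
    have := hz i
    omega

/-- **SUMS OVER THE BOX ARE SUMS OVER THE COARSE INDEX**. [folklore] -/
theorem sum_box_eq_sum_idx {M : Type*} [AddCommMonoid M] (N : Fin (d + 1) → ℕ) (g : (Fin (d + 1) → ℤ) → M) :
    ∑ y ∈ box N, g y = ∑ k : Idx N, g (toZ k) := by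
  classical
  rw [← image_toZ N, Finset.sum_image fun k _ k' _ h => toZ_injective h]

/-- extend a real vector on the coarse index to a complex function on `ℤ^{d+1}` (values on the representatives, `0` off
the box). [folklore] -/
def extR {N : Fin (d + 1) → ℕ} (x : Idx N → ℝ) : (Fin (d + 1) → ℤ) → ℂ :=
  fun y => ∑ k : Idx N, if toZ k = y then ((x k : ℝ) : ℂ) else 0

/-- the extension at a representative. [folklore] -/
theorem extR_toZ {N : Fin (d + 1) → ℕ} (x : Idx N → ℝ) (k : Idx N) : extR x (toZ k) = ((x k : ℝ) : ℂ) := by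
  classical
  unfold extR
  rw [Finset.sum_eq_single k (fun k' _ hne => if_neg fun h => hne (toZ_injective h))
    (fun h => absurd (Finset.mem_univ k) h), if_pos rfl]

/-- the `ℓ²` norm of the extension is the Euclidean norm of the vector. [folklore] -/
theorem sum_box_norm_extR {N : Fin (d + 1) → ℕ} (x : Idx N → ℝ) : ∑ y ∈ box N, ‖extR x y‖ ^ 2 = x ⬝ᵥ x := by
  rw [sum_box_eq_sum_idx]
  simp_rw [extR_toZ, Complex.norm_real, Real.norm_eq_abs, sq_abs, dotProduct, sq]

/-- **`Q′_kG′_k²Q′_k^*` AS A REAL MATRIX on the coarse index `Π_μ Fin N_μ`** (its entries are real, `qggq_im`).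
[cite: Balaban1984PropagatorsI, (1.45) p.26] -/
def qggqRe (n : ℕ) [NeZero n] (a : ℝ) (N : Fin (d + 1) → ℕ) : Matrix (Idx N) (Idx N) ℝ :=
  Matrix.of fun k k' => (qggq n a 0 N (toZ k) (toZ k')).re

/-- **the inverse kernel `(Q′_kG′_k²Q′_k^*)^{−1}` AS A REAL MATRIX** on the coarse index.
[cite: Balaban1984PropagatorsI, p.25] -/
def kerRe (n : ℕ) [NeZero n] (a : ℝ) (N : Fin (d + 1) → ℕ) : Matrix (Idx N) (Idx N) ℝ :=
  Matrix.of fun k k' => (torusKernel145M n a N (toZ k - toZ k')).re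

/-- the real matrix entry IS the complex kernel entry (the kernel is real). [folklore] -/
theorem qggqRe_coe (n : ℕ) [NeZero n] (hn1 : 1 ≤ n) (a : ℝ) (ha : 0 < a) {N : Fin (d + 1) → ℕ} (hN : ∀ i, 1 ≤ N i)
    (k k' : Idx N) : ((qggqRe n a N k k' : ℝ) : ℂ) = qggq n a 0 N (toZ k) (toZ k') := by
  apply Complex.ext
  · simp only [qggqRe, Matrix.of_apply, Complex.ofReal_re]
  · rw [Complex.ofReal_im, qggq_im n hn1 a 0 ha le_rfl hN]

/-- `qggqRe` is a symmetric matrix. [folklore] -/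
theorem qggqRe_isSymm (n : ℕ) [NeZero n] (hn1 : 1 ≤ n) (a : ℝ) (ha : 0 < a) {N : Fin (d + 1) → ℕ}
    (hN : ∀ i, 1 ≤ N i) : (qggqRe n a N).IsSymm :=
  Matrix.IsSymm.ext fun k k' => by
    simp only [qggqRe, Matrix.of_apply]
    rw [qggq_symm n hn1 a 0 ha le_rfl hN]

/-- **THE REAL QUADRATIC FORM IS THE COMPLEX ONE ON THE EXTENSION**:
`x·(qggqRe x) = Re Σ_{y,y′∈T₁} \overline{extR x (y)} qggq(y,y′) extR x (y′)`. [folklore] -/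
theorem dotProduct_qggqRe_mulVec (n : ℕ) [NeZero n] (a : ℝ) (N : Fin (d + 1) → ℕ) (x : Idx N → ℝ) :
    x ⬝ᵥ (qggqRe n a N *ᵥ x)
      = (∑ y ∈ box N, ∑ y' ∈ box N, conj (extR x y) * qggq n a 0 N y y' * extR x y').re := by
  rw [sum_box_eq_sum_idx]
  simp_rw [sum_box_eq_sum_idx N, extR_toZ, Complex.re_sum, Complex.conj_ofReal]
  simp only [dotProduct, Matrix.mulVec, qggqRe, Matrix.of_apply, Finset.mul_sum]
  refine Finset.sum_congr rfl fun k _ => Finset.sum_congr rfl fun k' _ => ?_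
  rw [Complex.re_mul_ofReal, Complex.re_ofReal_mul]
  ring

/-- **THE OPERATOR WINDOW FOR THE REAL MATRIX**: with the constants `0 < γ₀ ≤ γ₁` of `ev_window`,
`γ₀ (x·x) ≤ x·(qggqRe_{n,a,N} x) ≤ γ₁ (x·x)` for every `n ≥ 1`, `a ∈ [a₋,a₊]`, every period vector `N` (`N_μ ≥ 1`) and
every real vector `x` — the lower half literally `QGQInverse.Coercive (qggqRe n a N) γ₀`.
[cite: Balaban1984PropagatorsI, p.26, the sentence after (1.45)] -/
theorem qggqRe_window (d : ℕ) (aminus aplus : ℝ) (ha : 0 < aminus) :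
    ∃ γ₀ γ₁ : ℝ, 0 < γ₀ ∧ γ₀ ≤ γ₁ ∧ ∀ (n : ℕ) [NeZero n], 1 ≤ n → ∀ a : ℝ, aminus ≤ a → a ≤ aplus →
      ∀ (N : Fin (d + 1) → ℕ), (∀ i, 1 ≤ N i) →
        QGQInverse.Coercive (qggqRe n a N) γ₀ ∧ ∀ x : Idx N → ℝ, x ⬝ᵥ (qggqRe n a N *ᵥ x) ≤ γ₁ * (x ⬝ᵥ x) := by
  obtain ⟨γ₀, γ₁, h0, h01, h⟩ := qggq_operator_bounds d aminus aplus ha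
  refine ⟨γ₀, γ₁, h0, h01, fun n _ hn1 a ha1 ha2 N hN => ⟨fun x => ?_, fun x => ?_⟩⟩
  · rw [dotProduct_qggqRe_mulVec, ← sum_box_norm_extR]
    exact (h n hn1 a ha1 ha2 N hN (extR x)).1
  · rw [dotProduct_qggqRe_mulVec, ← sum_box_norm_extR]
    exact (h n hn1 a ha1 ha2 N hN (extR x)).2.1

/-- **HYPOTHESIS (β) OF `B5Decay126.decay126_torus` IN THE MULTIPLIER MODEL**: one `γ₀ > 0` with
`QGQInverse.Coercive (qggqRe n a N) γ₀` for every `n = L^k ≥ 1`, `a ∈ [a₋,a₊]` and every torus.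
[cite: Balaban1984PropagatorsI, p.26, the sentence after (1.45)] -/
theorem coercive_qggqRe (d : ℕ) (aminus aplus : ℝ) (ha : 0 < aminus) :
    ∃ γ₀ : ℝ, 0 < γ₀ ∧ ∀ (n : ℕ) [NeZero n], 1 ≤ n → ∀ a : ℝ, aminus ≤ a → a ≤ aplus →
      ∀ (N : Fin (d + 1) → ℕ), (∀ i, 1 ≤ N i) → QGQInverse.Coercive (qggqRe n a N) γ₀ := by
  obtain ⟨γ₀, γ₁, h0, -, h⟩ := qggqRe_window d aminus aplus ha
  exact ⟨γ₀, h0, fun n _ hn1 a ha1 ha2 N hN => (h n hn1 a ha1 ha2 N hN).1⟩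

/-- **`kerRe` IS A LEFT INVERSE OF `qggqRe`** (real part of `B5QGGQ145Torus.torusKernel145M_conv_qggq`).
[cite: Balaban1984PropagatorsI, p.25 ("the existence of the inverse operator")] -/
theorem kerRe_mul_qggqRe (n : ℕ) [NeZero n] (hn1 : 1 ≤ n) (a : ℝ) (ha : 0 < a) {N : Fin (d + 1) → ℕ}
    (hN : ∀ i, 1 ≤ N i) : kerRe n a N * qggqRe n a N = 1 := by
  classical
  ext k k''
  have hconv := torusKernel145M_conv_qggq n hn1 a ha hN (toZ k) (toZ k'')
  rw [if_congr (dvd_sub_iff_eq_of_mem_box (toZ_mem_box k) (toZ_mem_box k'')) rfl rfl, sum_box_eq_sum_idx] at hconv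
  have hre := congrArg Complex.re hconv
  rw [Complex.re_sum] at hre
  simp only [Matrix.mul_apply, kerRe, qggqRe, Matrix.of_apply, Matrix.one_apply]
  convert hre using 1
  · refine Finset.sum_congr rfl fun k' _ => ?_
    rw [Complex.mul_re, qggq_im n hn1 a 0 ha le_rfl hN, mul_zero, sub_zero]
  · simp only [toZ_injective.eq_iff]
    split_ifs <;> simp

/-- **`kerRe` IS A RIGHT INVERSE OF `qggqRe`** (real part of `B5QGGQ145Torus.qggq_conv_torusKernel145M`). [folklore] -/
theorem qggqRe_mul_kerRe (n : ℕ) [NeZero n] (hn1 : 1 ≤ n) (a : ℝ) (ha : 0 < a) {N : Fin (d + 1) → ℕ}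
    (hN : ∀ i, 1 ≤ N i) : qggqRe n a N * kerRe n a N = 1 := by
  classical
  ext k k''
  have hconv := qggq_conv_torusKernel145M n hn1 a ha hN (toZ k) (toZ k'')
  rw [if_congr (dvd_sub_iff_eq_of_mem_box (toZ_mem_box k) (toZ_mem_box k'')) rfl rfl, sum_box_eq_sum_idx] at hconv
  have hre := congrArg Complex.re hconv
  rw [Complex.re_sum] at hre
  simp only [Matrix.mul_apply, kerRe, qggqRe, Matrix.of_apply, Matrix.one_apply]
  convert hre using 1
  · refine Finset.sum_congr rfl fun k' _ => ?_
    rw [Complex.mul_re, qggq_im n hn1 a 0 ha le_rfl hN, zero_mul, sub_zero]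
  · simp only [toZ_injective.eq_iff]
    split_ifs <;> simp

/-- **THE INVERSE MATRIX**: `(qggqRe n a N)⁻¹ = kerRe n a N`. [cite: Balaban1984PropagatorsI, p.25] -/
theorem qggqRe_inv (n : ℕ) [NeZero n] (hn1 : 1 ≤ n) (a : ℝ) (ha : 0 < a) {N : Fin (d + 1) → ℕ}
    (hN : ∀ i, 1 ≤ N i) : (qggqRe n a N)⁻¹ = kerRe n a N :=
  Matrix.inv_eq_left_inv (kerRe_mul_qggqRe n hn1 a ha hN)

/-- **THE INVERSE KERNEL IS REAL**: `Im (Q′G′²Q′^*)^{−1}(x) = 0` for every `x ∈ ℤ^{d+1}` — the imaginary-part matrix `I`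
satisfies `I·qggqRe = 0` (imaginary part of the convolution identity, `qggq` being real), hence `I = I·qggqRe·kerRe = 0`;
a general `x` is reduced to a difference of representatives by periodicity. [folklore] -/
theorem torusKernel145M_im (n : ℕ) [NeZero n] (hn1 : 1 ≤ n) (a : ℝ) (ha : 0 < a) {N : Fin (d + 1) → ℕ}
    (hN : ∀ i, 1 ≤ N i) (x : Fin (d + 1) → ℤ) : (torusKernel145M n a N x).im = 0 := by
  classical
  -- Step 1: on differences of representatives
  set I : Matrix (Idx N) (Idx N) ℝ := Matrix.of fun k k' => (torusKernel145M n a N (toZ k - toZ k')).im with hIdef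
  have hI : I * qggqRe n a N = 0 := by
    ext k k''
    have hconv := torusKernel145M_conv_qggq n hn1 a ha hN (toZ k) (toZ k'')
    rw [sum_box_eq_sum_idx] at hconv
    have him := congrArg Complex.im hconv
    rw [Complex.im_sum] at him
    simp only [Matrix.mul_apply, qggqRe, Matrix.of_apply, Matrix.zero_apply, hIdef]
    convert him using 1
    · refine Finset.sum_congr rfl fun k' _ => ?_
      rw [Complex.mul_im, qggq_im n hn1 a 0 ha le_rfl hN, mul_zero, zero_add]
    · split_ifs <;> simp
  have hI0 : I = 0 := by
    calc I = I * (qggqRe n a N * kerRe n a N) := by rw [qggqRe_mul_kerRe n hn1 a ha hN, mul_one]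
      _ = 0 := by rw [← mul_assoc, hI, zero_mul]
  have key : ∀ k k' : Idx N, (torusKernel145M n a N (toZ k - toZ k')).im = 0 := fun k k' => by
    have := congrFun (congrFun hI0 k) k'
    simpa only [hIdef, Matrix.of_apply, Matrix.zero_apply] using this
  -- Step 2: a general `x` by periodicity
  have hw : wrap N x ∈ Finset.univ.image (toZ (N := N)) := by
    rw [image_toZ]; exact wrap_mem_box hN x
  obtain ⟨k, -, hk⟩ := Finset.mem_image.mp hw
  have hper : torusKernel145M n a N x = torusKernel145M n a N (wrap N x) := by
    rw [wrap_eq_translate, torusKernel145M_translate n a hN]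
  let k₀ : Idx N := fun i => ⟨0, hN i⟩
  have hk₀ : toZ k₀ = 0 := funext fun i => by simp [toZ, k₀]
  rw [hper, ← hk, show toZ k = toZ k - toZ k₀ by rw [hk₀, sub_zero]]
  exact key k k₀

/-- the real matrix entry IS the complex inverse-kernel entry. [folklore] -/
theorem kerRe_coe (n : ℕ) [NeZero n] (hn1 : 1 ≤ n) (a : ℝ) (ha : 0 < a) {N : Fin (d + 1) → ℕ} (hN : ∀ i, 1 ≤ N i)
    (k k' : Idx N) : ((kerRe n a N k k' : ℝ) : ℂ) = torusKernel145M n a N (toZ k - toZ k') := by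
  apply Complex.ext
  · simp only [kerRe, Matrix.of_apply, Complex.ofReal_re]
  · rw [Complex.ofReal_im, torusKernel145M_im n hn1 a ha hN]

/-- **THE INVERSE KERNEL IS EVEN**: `(Q′G′²Q′^*)^{−1}(−x) = (Q′G′²Q′^*)^{−1}(x)` (conjugation reflects the argument and
the kernel is real) — i.e. the inverse operator is symmetric. [folklore] -/
theorem torusKernel145M_even (n : ℕ) [NeZero n] (hn1 : 1 ≤ n) (a : ℝ) (ha : 0 < a) {N : Fin (d + 1) → ℕ}
    (hN : ∀ i, 1 ≤ N i) (x : Fin (d + 1) → ℤ) : torusKernel145M n a N (-x) = torusKernel145M n a N x := by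
  rw [← conj_torusKernel145M, Complex.conj_eq_iff_im.mpr (torusKernel145M_im n hn1 a ha hN x)]

/-- `kerRe` is a symmetric matrix. [folklore] -/
theorem kerRe_isSymm (n : ℕ) [NeZero n] (hn1 : 1 ≤ n) (a : ℝ) (ha : 0 < a) {N : Fin (d + 1) → ℕ}
    (hN : ∀ i, 1 ≤ N i) : (kerRe n a N).IsSymm :=
  Matrix.IsSymm.ext fun k k' => by
    simp only [kerRe, Matrix.of_apply]
    rw [← torusKernel145M_even n hn1 a ha hN, neg_sub]

end

end Literature.MathematicalPhysics.QuantumFieldTheory.Balaban1983to89.B5QGGQ145Bounds
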